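import Summits.QuantumFields.BalabanUV.T4Continuum.Support.DirichletCornerCutoutCover

/-!
# `BalabanUV.T4Continuum.Support.DirichletCutoutNearLocal` — NE2 (node U1a) formalisation swarm, sub-row `T4-U1a.S-NE2-D1-DIRICHLET°`, supplier item
# «Δ1-SKELETON» (file 12): THE NEAR PART, chart-free half — `‖∂_μᴴ∂_μ(η·z)‖² ≤ 4‖c‖²·E(η·z)`, the LOCAL energy of a cut field
# `E(η·z) ≤ 2·(energy of z on the bonds entering supp η) + 2‖c‖²ℓ²·(mass of z where η moves)`, and the SUPPORT of the corner bumps: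
# `Cb β κ₁ κ₂ y ≠ 0` puts `y` in the radius-`(R′ + R)` corner bundle `NC` (unit b2b-balaban-t4-ne2-formalise-leaf-08, gen 7, file 12)

HONEST FRAMING.  Rung (B)+1 bookkeeping at MODEL level, finite torus; [folklore] finite lattice calculus; NE2 (U1a) is NOT proved by this file;
spine PROVED 0/9 unchanged; NOT infinite volume, NOT the mass gap, NOT Clay.  HONEST DEPENDENCY (verbatim): «continuum YM on T⁴ ⇐ BetaPertH ∧
nine spine estimates (0/9 proved); BetaPertH ⇐ (D1) ∧ (D4) ∧ CAP+tail; G-an2-4 gates asym, D1 and NE2/3/4.»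

WHAT THIS FILE PROVES (0 sorry).  §1 **`nsq_sdiffH_sdiff_le_energy`**: `‖∂_μᴴ∂_μ w‖² ≤ 4‖c‖²·‖∂_μ w‖² ≤ 4‖c‖²·E(w)` (the trivial second-difference
bound — the one the near part uses on the cut-out, where the Morrey decay of files 8–10 of gen 6 makes the energy small).  §2 **`energy_cut_le_local`**:
for `0 ≤ η ≤ 1` with `|η(x+e_ν) − η x| ≤ ℓ` everywhere, `E(η·z) ≤ 2·Σ_ν Σ_{x : η(x+e_ν) ≠ 0} ‖(∂_νz)(x)‖² + 2‖c‖²ℓ²·Σ_ν Σ_{x : η(x+e_ν) ≠ η x} ‖z x‖²`.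
§3 **`NC_of_Cb_ne_zero`**: the support of a valid corner bump lies in the radius-`(R′ + R)` bundle of file 10 (`2 ≤ R`); hence
**`exists_NC_of_etaC_ne_zero`**: `etaC y ≠ 0 → ∃ valid (β, κ₁, κ₂), NC (R′+R) β κ₁ κ₂ y` — the geometric input of the chart cover (next file).

ABSOLUTE RULE (cell, verbatim): «No internally-minted statement may enter as a cited fact. Every hypothesis is either kernel-proved in
this package or a verbatim quotation of a PUBLISHED theorem with page reference. The manuscript(s) under audit are NOT citable for
their own disputed steps — they are the thing under adjudication; programme-internal (2001/route/tribunal) claims are never citable.»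
[folklore]; no definitions; no `def … : Prop` fact.  NOT CLAIMED: the decay cover, the two-level law; NE2; NE3.
-/

noncomputable section

open scoped BigOperators ComplexConjugate Matrix
open Finset

namespace Summit.QuantumFields.BalabanUV.T4Continuum.DirichletCutoutNearLocal

open Literature.MathematicalPhysics.QuantumFieldTheory.Balaban1983to89.B5Prop11Plancherel (Tor fine unitVec)
open Literature.MathematicalPhysics.QuantumFieldTheory.Balaban1983to89.B5Action121 (sdiff sdiff_mulVec sdiff_conjTranspose_mulVec)
open Literature.MathematicalPhysics.QuantumFieldTheory.Balaban1983to89.B5Prop11Lower (nsq nsq_nonneg)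
open Literature.MathematicalPhysics.QuantumFieldTheory.Balaban1983to89.B5Blocks16 (blockOf)
open Summit.QuantumFields.BalabanUV.T4Continuum.ScalarBlockPoincare (transS nsq_transS)
open Summit.QuantumFields.BalabanUV.T4Continuum.DirichletMonotoneCutoff (offsF)
open Summit.QuantumFields.BalabanUV.T4Continuum.DirichletDirectionalBesovCutoff (cut energy nsq_sdiff_le_energy sdiff_cut)
open Summit.QuantumFields.BalabanUV.T4Continuum.ScaleProfile (qprof qprof_eq_zero)
open Summit.QuantumFields.BalabanUV.T4Continuum.DirichletDipCutoff (BotExp)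
open Summit.QuantumFields.BalabanUV.T4Continuum.DirichletDipCutoffAxis (liftA)
open Summit.QuantumFields.BalabanUV.T4Continuum.DirichletCornerCutout (Hp Dp Ep)
open Summit.QuantumFields.BalabanUV.T4Continuum.DirichletCornerCutoutEta (cfac Cb CornerIdx gfac etaC)
open Summit.QuantumFields.BalabanUV.T4Continuum.DirichletCornerCutoutCover (NearPlaneR NearFaceR InWinR NC)

variable {d : ℕ} (N : Fin d → ℕ) [hN : ∀ μ, NeZero (N μ)]

/-! ## §1 The trivial second-difference bound -/

/-- `‖∂_μᴴ u‖² ≤ 4‖c‖²‖u‖²`. [folklore] -/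
theorem nsq_sdiffH_le (c : ℂ) (μ : Fin d) (u : Tor N → ℂ) : nsq ((sdiff N c μ)ᴴ *ᵥ u) ≤ 4 * ‖c‖ ^ 2 * nsq u := by
  have hpt : ∀ x, ‖((sdiff N c μ)ᴴ *ᵥ u) x‖ ^ 2 ≤ 2 * ‖c‖ ^ 2 * ‖u (x - unitVec N μ)‖ ^ 2 + 2 * ‖c‖ ^ 2 * ‖u x‖ ^ 2 := by
    intro x
    rw [sdiff_conjTranspose_mulVec, norm_mul, Complex.norm_conj]
    have h := norm_sub_le (u (x - unitVec N μ)) (u x)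
    have h1 : ‖u (x - unitVec N μ) - u x‖ ^ 2 ≤ 2 * ‖u (x - unitVec N μ)‖ ^ 2 + 2 * ‖u x‖ ^ 2 := by
      have h2 : ‖u (x - unitVec N μ) - u x‖ ^ 2 ≤ (‖u (x - unitVec N μ)‖ + ‖u x‖) ^ 2 := pow_le_pow_left₀ (norm_nonneg _) h 2
      nlinarith [sq_nonneg (‖u (x - unitVec N μ)‖ - ‖u x‖)]
    calc (‖c‖ * ‖u (x - unitVec N μ) - u x‖) ^ 2 = ‖c‖ ^ 2 * ‖u (x - unitVec N μ) - u x‖ ^ 2 := by ring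
      _ ≤ ‖c‖ ^ 2 * (2 * ‖u (x - unitVec N μ)‖ ^ 2 + 2 * ‖u x‖ ^ 2) := mul_le_mul_of_nonneg_left h1 (sq_nonneg _)
      _ = _ := by ring
  have hT : ∑ x, ‖u (x - unitVec N μ)‖ ^ 2 = nsq u := by
    have : (fun x => u (x - unitVec N μ)) = transS N (-unitVec N μ) u := by funext x; simp [transS, sub_eq_add_neg]
    rw [show ∑ x, ‖u (x - unitVec N μ)‖ ^ 2 = nsq (fun x => u (x - unitVec N μ)) from rfl, this, nsq_transS]
  unfold nsq at *
  calc ∑ x, ‖((sdiff N c μ)ᴴ *ᵥ u) x‖ ^ 2 ≤ ∑ x, (2 * ‖c‖ ^ 2 * ‖u (x - unitVec N μ)‖ ^ 2 + 2 * ‖c‖ ^ 2 * ‖u x‖ ^ 2) :=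
        Finset.sum_le_sum fun x _ => hpt x
    _ = 2 * ‖c‖ ^ 2 * ∑ x, ‖u (x - unitVec N μ)‖ ^ 2 + 2 * ‖c‖ ^ 2 * ∑ x, ‖u x‖ ^ 2 := by
        rw [Finset.sum_add_distrib, Finset.mul_sum, Finset.mul_sum]
    _ = 4 * ‖c‖ ^ 2 * ∑ x, ‖u x‖ ^ 2 := by rw [hT]; ring

/-- **`‖∂_μᴴ∂_μ w‖² ≤ 4‖c‖²·E(w)`**. [folklore] -/
theorem nsq_sdiffH_sdiff_le_energy (c : ℂ) (μ : Fin d) (w : Tor N → ℂ) :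
    nsq ((sdiff N c μ)ᴴ *ᵥ (sdiff N c μ *ᵥ w)) ≤ 4 * ‖c‖ ^ 2 * energy N c w :=
  (nsq_sdiffH_le N c μ _).trans (mul_le_mul_of_nonneg_left (nsq_sdiff_le_energy N c μ w) (by positivity))

/-! ## §2 The local energy of a cut field -/

/-- pointwise: `‖∂_ν(ηz)(x)‖² ≤ 2·[η(x+e_ν) ≠ 0]·‖∂_νz(x)‖² + 2‖c‖²ℓ²·[η(x+e_ν) ≠ η x]·‖z x‖²`. [folklore] -/
theorem norm_sdiff_cut_sq_le_local (c : ℂ) (ν : Fin d) {η : Tor N → ℝ} {ℓ : ℝ} (h0 : ∀ x, 0 ≤ η x) (h1 : ∀ x, η x ≤ 1)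
    (hlip : ∀ x, |η (x + unitVec N ν) - η x| ≤ ℓ) (z : Tor N → ℂ) (x : Tor N) :
    ‖(sdiff N c ν *ᵥ cut N η z) x‖ ^ 2
      ≤ 2 * (if η (x + unitVec N ν) ≠ 0 then ‖(sdiff N c ν *ᵥ z) x‖ ^ 2 else 0)
        + 2 * ‖c‖ ^ 2 * ℓ ^ 2 * (if η (x + unitVec N ν) ≠ η x then ‖z x‖ ^ 2 else 0) := by
  rw [sdiff_cut]
  simp only [Pi.add_apply, Pi.smul_apply, smul_eq_mul, cut]
  set A := (η (x + unitVec N ν) : ℂ) * (sdiff N c ν *ᵥ z) x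
  set B := c * (((η (x + unitVec N ν) - η x : ℝ) : ℂ) * z x)
  have hAB : ‖A + B‖ ^ 2 ≤ 2 * ‖A‖ ^ 2 + 2 * ‖B‖ ^ 2 := by
    have h2 : ‖A + B‖ ^ 2 ≤ (‖A‖ + ‖B‖) ^ 2 := pow_le_pow_left₀ (norm_nonneg _) (norm_add_le A B) 2
    nlinarith [sq_nonneg (‖A‖ - ‖B‖)]
  have hA : ‖A‖ ^ 2 ≤ (if η (x + unitVec N ν) ≠ 0 then ‖(sdiff N c ν *ᵥ z) x‖ ^ 2 else 0) := by
    split_ifs with h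
    · simp only [A, norm_mul, Complex.norm_real, Real.norm_eq_abs, abs_of_nonneg (h0 _)]
      exact pow_le_pow_left₀ (mul_nonneg (h0 _) (norm_nonneg _)) (mul_le_of_le_one_left (norm_nonneg _) (h1 _)) 2
    · push Not at h; simp [A, h]
  have hB : ‖B‖ ^ 2 ≤ ‖c‖ ^ 2 * ℓ ^ 2 * (if η (x + unitVec N ν) ≠ η x then ‖z x‖ ^ 2 else 0) := by
    split_ifs with h
    · simp only [B, norm_mul, Complex.norm_real, Real.norm_eq_abs]
      have hl := hlip x
      have : |η (x + unitVec N ν) - η x| ^ 2 ≤ ℓ ^ 2 := pow_le_pow_left₀ (abs_nonneg _) hl 2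
      nlinarith [norm_nonneg c, norm_nonneg (z x), abs_nonneg (η (x + unitVec N ν) - η x), mul_nonneg (sq_nonneg ‖c‖) (sq_nonneg ‖z x‖),
        mul_le_mul_of_nonneg_left this (mul_nonneg (sq_nonneg ‖c‖) (sq_nonneg ‖z x‖))]
    · push Not at h; simp [B, h]
  linarith

/-- **LOCAL ENERGY OF A CUT FIELD**: `E(ηz) ≤ 2·Σ_ν Σ_{x : η(x+e_ν) ≠ 0} ‖∂_νz(x)‖² + 2‖c‖²ℓ²·Σ_ν Σ_{x : η(x+e_ν) ≠ η x} ‖z x‖²` for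
`0 ≤ η ≤ 1` with steps `≤ ℓ`. [folklore] -/
theorem energy_cut_le_local (c : ℂ) {η : Tor N → ℝ} {ℓ : ℝ} (h0 : ∀ x, 0 ≤ η x) (h1 : ∀ x, η x ≤ 1)
    (hlip : ∀ x (ν : Fin d), |η (x + unitVec N ν) - η x| ≤ ℓ) (z : Tor N → ℂ) :
    energy N c (cut N η z)
      ≤ 2 * ∑ ν : Fin d, ∑ x, (if η (x + unitVec N ν) ≠ 0 then ‖(sdiff N c ν *ᵥ z) x‖ ^ 2 else 0)
        + 2 * ‖c‖ ^ 2 * ℓ ^ 2 * ∑ ν : Fin d, ∑ x, (if η (x + unitVec N ν) ≠ η x then ‖z x‖ ^ 2 else 0) := by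
  unfold energy nsq
  calc ∑ ν, ∑ x, ‖(sdiff N c ν *ᵥ cut N η z) x‖ ^ 2
      ≤ ∑ ν : Fin d, ∑ x, (2 * (if η (x + unitVec N ν) ≠ 0 then ‖(sdiff N c ν *ᵥ z) x‖ ^ 2 else 0)
          + 2 * ‖c‖ ^ 2 * ℓ ^ 2 * (if η (x + unitVec N ν) ≠ η x then ‖z x‖ ^ 2 else 0)) :=
        Finset.sum_le_sum fun ν _ => Finset.sum_le_sum fun x _ => norm_sdiff_cut_sq_le_local N c ν h0 h1 (fun x => hlip x ν) z x
    _ = _ := by simp only [Finset.sum_add_distrib, ← Finset.mul_sum]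

/-! ## §3 The support of the corner bumps -/

section Support

variable {N} {n : ℕ} [NeZero n] {M : Fin d → ℕ} [hM : ∀ μ, NeZero (M μ)] {S : Tor M → Prop} [DecidablePred S] {μ : Fin d} {R R' : ℕ}
  (hR : 2 ≤ R)
include hR

omit hN in
/-- `q′ i ≠ 0` forces `i + 2 ≤ R′ + R`. [folklore] -/
theorem le_of_qprof_ne_zero' {i : ℕ} (h : qprof R R' i ≠ 0) : i + 2 ≤ R' + R := by
  by_contra h'; exact h (qprof_eq_zero hR R' (by omega))

omit hN [DecidablePred S] in
/-- **the support of a corner bump lies in the radius-`(R′ + R)` bundle.** [folklore] -/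
theorem NC_of_Cb_ne_zero {β : Tor M} {κ₁ κ₂ : Fin d} (hidx : CornerIdx M S μ β κ₁ κ₂) {y : Tor (fine n M)}
    (h : Cb n M μ R R' β κ₁ κ₂ y ≠ 0) : NC n M μ (R' + R) β κ₁ κ₂ y := by
  have hf : ∀ lam, cfac n M μ R R' β κ₁ κ₂ lam y ≠ 0 := fun lam => (Finset.prod_ne_zero_iff.mp h) lam (Finset.mem_univ _)
  -- the face clause from a non-zero two-sided slab
  have faceD : ∀ κ, liftA n M κ (Dp (n := n) R R' (β κ)) y ≠ 0 → NearFaceR n M (R' + R) β κ y := by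
    intro κ hκ
    unfold liftA Dp at hκ
    by_cases hb : blockOf n M y κ = β κ
    · rw [if_pos hb] at hκ
      by_cases hq : qprof R R' (offsF n M y κ : ℕ) = 0
      · rw [hq, zero_add] at hκ; exact Or.inl ⟨hb, Or.inr (by have := le_of_qprof_ne_zero' hR hκ; omega)⟩
      · exact Or.inl ⟨hb, Or.inl (by have := le_of_qprof_ne_zero' hR hq; omega)⟩
    · rw [if_neg hb] at hκ
      by_cases hb1 : blockOf n M y κ = β κ + 1
      · by_cases hq : qprof R R' (offsF n M y κ : ℕ) = 0
        · rw [if_pos hb1, hq, zero_add] at hκ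
          split_ifs at hκ with hb2
          · exact Or.inr (Or.inr ⟨hb2, by have := le_of_qprof_ne_zero' hR hκ; omega⟩)
          · exact absurd rfl hκ
        · exact Or.inr (Or.inl ⟨hb1, by have := le_of_qprof_ne_zero' hR hq; omega⟩)
      · rw [if_neg hb1, zero_add] at hκ
        split_ifs at hκ with hb2
        · exact Or.inr (Or.inr ⟨hb2, by have := le_of_qprof_ne_zero' hR hκ; omega⟩)
        · exact absurd rfl hκ
  have faceE : ∀ κ, liftA n M κ (Ep (n := n) R R' (β κ)) y ≠ 0 → InWinR n M (R' + R) β κ y := by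
    intro κ hκ
    unfold liftA Ep at hκ
    by_cases hb : blockOf n M y κ = β κ
    · exact Or.inl hb
    · rw [if_neg hb] at hκ
      right
      by_cases hb1 : blockOf n M y κ = β κ + 1
      · by_cases hq : qprof R R' (offsF n M y κ : ℕ) = 0
        · rw [if_pos hb1, hq, zero_add] at hκ
          split_ifs at hκ with hb2
          · exact Or.inr (Or.inr ⟨hb2, by have := le_of_qprof_ne_zero' hR hκ; omega⟩)
          · exact absurd rfl hκ
        · exact Or.inr (Or.inl ⟨hb1, by have := le_of_qprof_ne_zero' hR hq; omega⟩)
      · rw [if_neg hb1, zero_add] at hκ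
        split_ifs at hκ with hb2
        · exact Or.inr (Or.inr ⟨hb2, by have := le_of_qprof_ne_zero' hR hκ; omega⟩)
        · exact absurd rfl hκ
  refine ⟨?_, ?_, ?_, fun lam hl => ?_⟩
  · have h1 := hf μ
    unfold cfac at h1; rw [if_pos rfl] at h1
    unfold liftA Hp at h1
    split_ifs at h1 with hb hb'
    · exact Or.inl ⟨hb, by have := le_of_qprof_ne_zero' hR h1; omega⟩
    · exact Or.inr ⟨hb', by have := le_of_qprof_ne_zero' hR h1; omega⟩
    · exact absurd rfl h1
  · have h1 := hf κ₁
    unfold cfac at h1; rw [if_neg hidx.2.1, if_pos (Or.inl rfl)] at h1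
    exact faceD κ₁ h1
  · have h1 := hf κ₂
    unfold cfac at h1; rw [if_neg hidx.2.2.1, if_pos (Or.inr rfl)] at h1
    exact faceD κ₂ h1
  · have h1 := hf lam
    unfold cfac at h1; rw [if_neg hl] at h1
    by_cases h2 : lam = κ₁ ∨ lam = κ₂
    · rw [if_pos h2] at h1; exact Or.inr (faceD lam h1)
    · rw [if_neg h2] at h1; exact faceE lam h1

omit hN in
/-- **the support of `etaC`**: `etaC y ≠ 0` gives a valid corner index whose radius-`(R′+R)` bundle contains `y`. [folklore] -/
theorem exists_NC_of_etaC_ne_zero {y : Tor (fine n M)} (h : etaC n M S μ R R' y ≠ 0) :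
    ∃ β κ₁ κ₂, CornerIdx M S μ β κ₁ κ₂ ∧ NC n M μ (R' + R) β κ₁ κ₂ y := by
  unfold etaC at h
  have h' : ∏ i : Tor M × Fin d × Fin d, gfac n M S μ R R' i.1 i.2.1 i.2.2 y ≠ 1 := fun h1 => h (by rw [h1, sub_self])
  by_contra hall
  push Not at hall
  apply h'
  refine Finset.prod_eq_one fun i _ => ?_
  unfold gfac
  split_ifs with hidx
  · by_cases hC : Cb n M μ R R' i.1 i.2.1 i.2.2 y = 0
    · rw [hC, sub_zero]
    · exact absurd (NC_of_Cb_ne_zero hR hidx hC) (hall i.1 i.2.1 i.2.2 hidx)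
  · rw [sub_zero]

end Support

end Summit.QuantumFields.BalabanUV.T4Continuum.DirichletCutoutNearLocal

end
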